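import Mathlib
import HarnessLib
import HarnessLib.Audit
import Summits.CriticalPhenomena.Statement

/-!
Route: PercCCDGraph

CLOSED (retired) 2026-08-15T13:47:57Z by operator:999:1257524 — reason: not-a-thesis: assembly does not conclude the sub-problem Statement — note: D-0027 §2.1 audit (human 2026-08-15: routes that do not decide the summit are removed): the assembly concludes `CCDGraphZ3`, not the sub-problem statement; a NEW conforming route may be opened from the same idea (generated `closes : … → _root_.PercolationContinuityZ3`).. The file is kept as the record of this route; refuted decls are indexed as negative knowledge (`ledger negatives`).

# Route PercCCDGraph — Chayes-Chayes-Durrett graph over Z^3 (barrier route) - same p_c as Z^3,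
percolates at p_c

BARRIER ROUTE (D-0021 negative knowledge), realising idea card ccd-decorated-lattice. It is declared
up front that X does NOT
imply Summit.CriticalPhenomena.PercolationContinuityZ3 and is not claimed to: X is a no-go theorem
for a technique class, and the
Assembly item is the glue DecoratedSlabsSupercritical → SlabsToBlocks → EnhancementThresholdLimit →
CCDGraphZ3 (conclusion = the
barrier target); the deliverable is a Theorems file that a literature seat can vendor as
Literature/Barriers/CriticalPhenomena/CCDDecoratedLattice. X = CCDGraphZ3: there is a simple graph G
on the vertex set of ℤ³ with
ℤ³ ≤ G ≤ the unit-cube graph (every extra edge joins sites at sup-distance 1; so degree ≤ 26, cubic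
volume growth, identity map a
rough isometry onto ℤ³) whose bond-percolation critical point at the origin EQUALS p_c(ℤ³) and which
percolates AT that point,
θ_G(0; p_c(ℤ³)) > 0. Consequently every argument for θ(p_c) = 0 whose steps hold for all
bounded-degree unit-cube supergraphs of
ℤ³ with unchanged critical point is void; a proof on ℤ³ must use translation invariance
(quasi-transitivity) beyond geometry,
independence, FKG/BK/Russo, finite energy and amenable uniqueness — all of which G shares. The
intended G: ℤ³ decorated on
dyadic shells [2^{J_k}, 2^{J_{k+1}}) by the periodic 26-neighbour gadget at the sites of (m_k ℤ)³,
m_k = 2^k m₀ (nested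
patterns D_{m_{k+1}} ≤ D_{m_k}), radii chosen AFTER the patterns (fixed-pattern engine; no
uniformity in the decoration density).
Lean: `∃ G : SimpleGraph (Literature.Probability.LatticeModels.Site 3),
Literature.Probability.LatticeModels.zdGraph 3 ≤ G ∧ (∀ x y :
Literature.Probability.LatticeModels.Site 3, G.Adj x y → ∀ i, |x i - y i| ≤ 1) ∧
Literature.Probability.Percolation.criticalProb G 0 =
Literature.Probability.Percolation.criticalProb (Literature.Probability.LatticeModels.zdGraph 3) 0 ∧
0 < Literature.Probability.Percolation.theta G 0 (Literature.Probability.Percolation.criticalProbI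
3)`

## Assembly
NOT an implication to the conjunct (barrier route): the assembly concludes in the target CCDGraphZ3.
Proof content (standard
reductions, all inside the prover's Theorems file with helpers riding as --supports): fix m_k = 2^k
(nested patterns
D_{m_{k+1}} ≤ D_{m_k}); by DecoratedSlabsSupercritical and SlabsToBlocks at p = criticalProbI 3 the
bad-block suprema
ε_{m_k}(2^j) are summable in j, so choose J_k ↑ ∞ with Σ_{j ≥ J_k} ε_{m_k}(2^j) ≤ 2^{−k}/C (C =
number of blocks of scale
2^{j−3} per dyadic annulus, a fixed constant); let G = ℤ³ ⊔ (gadget edges of D_{m_k} inside the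
shell 2^{J_k} ≤ ‖x‖ < 2^{J_{k+1}}).
Evaluate each block of annulus j on ω ∩ E(D^{(x)}) where D^{(x)} is the COARSEST pattern meeting
B(x, 3·2^{j−3}) (so its edges lie
in G and its law under bondPercolation G is that under bondPercolation D^{(x)}: equal product
marginals); neighbouring and
cross-scale good blocks glue through clause (b) of the block with the finer pattern (a crossing of
B(x,n) in direction i has
extent 2n inside B(x,n) ∩ B(x ± n e_i, n); a good 2n-block at sup-distance ≤ n contains the
n-block's box in its 3·2n box), hence
with positive probability all blocks beyond a finite annulus are good and G contains an infinite
open cluster, so θ_G(v) > 0 for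
some v and θ_G(0) > 0 by theta_pos_of_adj along a path (G ⊇ ℤ³ connected); thus p_c(G) ≤ p_c(ℤ³).
Conversely for p < p_c(ℤ³),
EnhancementThresholdLimit gives K with p < p_c(D_{m_K}); G ≤ D_{m_K} ⊔ (finitely many edges), whose
clusters at p are a.s. finite
(θ = 0 at every vertex of D_{m_K}, finitely many finite clusters merged), and θ is monotone in the
graph (product-measure
coupling), so θ_G(0, p) = 0; hence p_c(G) ≥ p_c(ℤ³). The unit-cube and ℤ³ ≤ G clauses hold by
construction.

Rationale: WHY THIS LINE. Chayes–Chayes–Durrett (ChayesChayesDurrett1987, Thm 2) tune the PARAMETER p(x) ↓ p_c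
on ℤ² so slowly that supercritical shells
glue into an incipient infinite cluster; this route tunes the GRAPH instead, at the single parameter
p_c(ℤ³): on shell k the
periodically decorated lattice D_{m_k} ⊋ ℤ³ is strictly supercritical at p_c(ℤ³) (Aizenman–Grimmett
essential enhancement,
AizenmanGrimmett1991 = GrimmettPercolation1999 §3.3 Example B p.66, combined with
Grimmett–Marstrand, GrimmettMarstrand1990, which
is PROVED in the tree as Literature.Probability.Percolation.GrimmettMarstrand1990_blocks_holds), so
static renormalisation
(GrimmettPercolation1999 Thm (7.61), Lemma (7.89); Pisztora1996) makes its blocks good with summably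
small failure along dyadic
scales, and consecutive shells glue through the local-uniqueness clause of the finer pattern
(D_{m_{k+1}} ≤ D_{m_k}); sparser
patterns outward keep p_c(G) = p_c(ℤ³) by a branching comparison resting on quasi-transitive
sharpness (PROVED:
Literature.Probability.Percolation.DCTQ.summable_real_openConn_of_lt_criticalProb). Imported areas:
inhomogeneous/incipient
percolation (CCD), strict critical-point inequalities (AG), supercritical coarse graining (GM,
Pisztora; robust variant
ContrerasMartineauTassion2024 for transitive polynomial growth). What it does that prior routes do
not: it is the first
negative-side route of this sub-problem (the 9 existing Theses are positive criteria) and it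
sharpens the catalogued barrier
TreesPercolatingAtCriticality from exponential-growth trees to a cubic-growth perturbation of ℤ³
itself with unchanged p_c — the
exact gap that barrier's audit records; the negatives index (1 SAW item) is untouched.

RANKED CRUXES. #0 CCDGraphZ3 (target) — the Chayes–Chayes–Durrett graph over ℤ³: a unit-cube
supergraph G of ℤ³ (same vertices, extra edges only between sites at sup-distance 1) with
criticalProb G 0 = criticalProb ℤ³ 0 and θ_G(0; p_c(ℤ³)) > 0 (card ccd-decorated-lattice, item r2).
(why it might fail: Only through the engine: if no decorated lattice D_m is strictly
slab-supercritical at p_c(ℤ³) (crux 2 false for all large m) the shell gluing has nothing to run on;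
the statement itself fails only if sparse periodic essential enhancements did not lower p_c.)
[ChayesChayesDurrett1987, AizenmanGrimmett1991, GrimmettMarstrand1990, GrimmettPercolation1999,
AngelHutchcroft2018]
#2 DecoratedSlabsSupercritical (crux) — for every period m ≥ 1 the decorated lattice D_m := ℤ³ ⊔
{all unit-cube edges at the sites of (mℤ)³} has a slab S_K = {0 ≤ x₂ ≤ K} whose induced graph has
critical point (at the origin) STRICTLY below p_c(ℤ³): the enhancement's supercriticality at p_c(ℤ³)
is slab-visible (card items r3/S3 in the refuter's fixed-pattern form). Two proofs foreseen: (i)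
Grimmett–Marstrand for ℤ³ (PROVED, GrimmettMarstrand1990_blocks_holds: p_c(S_K(ℤ³)) ↓ p_c) plus an
Aizenman–Grimmett gain p_c(S_K(ℤ³)) − p_c(S_K(D_m)) ≥ δ(m) > 0 uniform in K ≥ K₀(m) (the AG local
surgery has finitely many local types uniformly in K); (ii) port GM's dynamic renormalisation to the
mℤ³-periodic, hyperoctahedrally symmetric D_m and use AG on the full lattice
(GrimmettPercolation1999 §3.3 Example B). [difficulty: L] (why it might fail: Needs the AG gain in
slabs bounded below uniformly in the width K (to beat the GM gap p_c(S_K)−p_c→0) or a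
Grimmett–Marstrand theorem for the quasi-transitive D_m; both expected, neither written, and BBR
(arXiv:1402.0834) found gaps in AG-type proofs.) [AizenmanGrimmett1991, GrimmettMarstrand1990,
GrimmettPercolation1999, BalisterBollobasRiordan2014, MartineauTassion2017,
ContrerasMartineauTassion2024]
#3 SlabsToBlocks (crux) — static renormalisation for the decorated lattices (Grimmett 1999 Thm
(7.61) / Pisztora ported to D_m): if some slab of D_m has critical point strictly below p, then at
parameter p the block events V_m(x, n) — (a) the box B(x,n) = x + [−n,n]³ contains an open cluster
joining, inside B(x,n), the two opposite faces in each of the three directions; (b) any two open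
paths inside B(x,3n), each of sup-extent ≥ n, are joined by an open path inside B(x,3n) — fail with
probability whose supremum over the centre x is summable along the dyadic scales n = 2^j
(exponential in n is expected). This is the fixed-pattern engine of the shell gluing; periodicity
makes the supremum a finite maximum. [deps: DecoratedSlabsSupercritical] [difficulty: XL] (why it
might fail: Thm (7.61)/Lemma (7.89) (crossing cluster + local uniqueness by orange-peeling with slab
seeds and p′<p sprinkling) are written for ℤ^d using all its symmetries; D_m is only mℤ³-periodic
with point symmetry at decorated sites, and uniqueness is asked at extent ratio 1/6 with a summable
rate.) [GrimmettPercolation1999, Pisztora1996, GrimmettMarstrand1990, ContrerasMartineauTassion2024]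
#4 CCDGraphZ2 (crux) — planar warm-up (card item r4): a unit-square supergraph G of ℤ² (extra edges
only between sites at sup-distance 1) with criticalProb G 0 = criticalProb ℤ² 0 (= 1/2 by Kesten,
not needed in this form) and θ_G(0; p_c(ℤ²)) > 0. Intended: NE-diagonals on the lines m_k ∣ x₀ − x₁
(planar, 2-fold symmetric, period m_k), sparser on outer dyadic shells; on shell k the decorated
planar lattice is strictly supercritical at 1/2 (AG in the plane), its dual strictly subcritical
(p_c(D)+p_c(D*)=1 for symmetric planar lattices, BollobasRiordan2008; quasi-transitive sharpness,
PROVED in tree), so open circuits in dyadic annuli exist with summable failure and glue by planarity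
— CCD87's proof with the graph in place of the parameter. Already a clean new example: a
bounded-degree planar graph rough-isometric to ℤ² with p_c = 1/2 percolating at criticality.
[difficulty: L] (why it might fail: Statement-level risk is low; the proof needs p_c(D)+p_c(D*)=1
for a 2-fold-symmetric decorated planar lattice (Bollobás–Riordan 2008) or an RSW theory for it,
plus strict p_c(D)<1/2 (planar AG); a gadget lacking the symmetry breaks the duality step.)
[ChayesChayesDurrett1987, BollobasRiordan2008, AizenmanGrimmett1991, GrimmettPercolation1999,
DuminilCopinTassionCMP2016]
#9 EnhancementThresholdLimit (support) — the critical points of the decorated lattices tend to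
p_c(ℤ³) as the decoration rarefies: for every real p < p_c(ℤ³) there is M with p < p_c(D_m) for all
m ≥ M (card item S2). Proof: at p′ ∈ (p, p_c(ℤ³)) the ℤ³-susceptibility is finite (PROVED
quasi-transitive sharpness, summable_real_openConn_of_lt_criticalProb), so a D_m-cluster is
dominated by a branching process of ℤ³-clusters linked through open gadget edges whose mean
offspring is ≤ 27·20·Σ_{‖w‖≥m−2} τ_{p′}(w) → 0; hence θ_{D_m}(p′) = 0 and p < p′ ≤ p_c(D_m) for m ≥
M(p′). [difficulty: M] [GrimmettPercolation1999, DuminilCopinTassionCMP2016, AntunovicVeselic2007]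

TWO-LAYER PLAN. Foreseen glued splits (k ≤ 3, depth 1), filed only after a crux closes or stalls:
DecoratedSlabsSupercritical ⇐ SlabEnhancementGain
(AG differential inequality for S_K(D_m) ⊋ S_K(ℤ³) with constants uniform in K ≥ K₀(m)) →
GMGapClosure (PROVED GM: p_c(S_K(ℤ³)) ↓
p_c(ℤ³)) → DecoratedSlabsSupercritical; SlabsToBlocks ⇐ CrossingClusterExistence (clause (a), from
slab percolation in the three
orientations, symmetric gadget) → LocalUniquenessPeeling (clause (b), Lemma (7.89)-type with p′ < p
sprinkling inside the
supercritical slab regime) → SlabsToBlocks; CCDGraphZ2 ⇐ PlanarStrictEnhancement →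
DualCircuitSummability → CCDGraphZ2.

KILL CRITERIA. DecoratedSlabsSupercritical refuted for all large m (no slab of D_m strictly
supercritical at p_c(ℤ³), i.e. Grimmett–Marstrand
failing for a periodic decoration of ℤ³) closes the route `refuted:DecoratedSlabsSupercritical` —
and is itself worth recording.
SlabsToBlocks refuted as stated (non-summable bad blocks at a strictly slab-supercritical p) forces
a pivot to a weaker block
event (uniqueness window v·log n or boxes 5n, Grimmett (b′)) via --restate, not a close. CCDGraphZ2
refuted would contradict the
CCD87 mechanism in its home dimension: close. A published construction of a graph rough-isometric to
ℤ^d with p_c = p_c(ℤ^d)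
percolating at p_c makes the route `known` (vendor it as the Literature barrier and close
superseded). A proof of θ(p_c) = 0 on
ℤ³ does not refute anything here (the barrier stays true) but moots the staffing.

NOT DECOMPOSED YET. The AG differential inequality and its K-uniformity (children of crux 2); the
GM-port alternative; clause (a)/(b) of the static
renormalisation as separate lemmas (children of crux 3); the 2-D strictness/duality/circuit lemmas
(children of crux 4); the
assembly's bookkeeping (product-measure marginal transfer for events of D^{(x)}-edges, block
geometry of dyadic annuli, finite
modification and graph-monotonicity of θ) — helper lemmas riding with --supports, never items; the
density-zero remark
θ_G(x; p_c) → 0 of the card (S4) is DROPPED: it would require θ_{ℤ³}(p_c) = 0 itself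
(θ_{D_m}(p_c(ℤ³)) ≥ θ_{ℤ³}(p_c(ℤ³))).

CHEAPEST FALSIFIER. (1) Lookup: is a bounded-degree graph rough-isometric to ℤ^d with p_c = p_c(ℤ^d)
and θ(p_c) > 0 already in print (Benjamini–Schramm
1996 questions on rough-isometry invariance; LyonsPeres2016 §7–8 notes; Häggström–Peres–Schonmann
1999)? If yes the route is
`known` (still vendor the barrier). Ran: crossref ×4 and the Trees-barrier audit — nothing beyond
CCD87 (parameter-inhomogeneous),
Grimmett's log-wedge (Thm (11.55), p_c shifted, not rough-isometric) and Angel–Hutchcroft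
(exponential growth). (2) A 10-minute
Monte-Carlo (kit) of the planar decorated lattice ℤ² + NE-diagonals on lines m ∣ x₀−x₁, m = 8, at p
= 1/2: box-crossing
probabilities of D must drift to 1 with the scale (strict supercriticality); and of D_m ⊂ ℤ³, m = 4,
at p = 0.2488 in slabs of
width 8–16: crossing probabilities increasing with the lateral size. Not run here (hub compute-free;
left to the refuter).

NUMBERS. p_c(ℤ³, bond) ≈ 0.2488126 (numerical; Wang–Zhou–Zhang–Garoni–Deng 2013); p_c(ℤ², bond) =
1/2 (Kesten, named fact
kesten_criticalProb_Z2); degrees: ℤ³ 6, D_m ≤ 26 + 6·? (decorated site 26, neighbours of decorated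
sites ≤ 6 + 8), G ≤ 26;
|B(n)| = (2n+1)³ for G (same vertex set); GM: p_c(S_K) ↓ p_c(ℤ³) (PROVED in tree); items at open: 6
(target, 3 cruxes, 1 support,
assembly).

DEFINITION REQUESTS. None. The decorated lattice D_m is inlined (`zdGraph 3 ⊔ SimpleGraph.fromRel
…`) in each statement; slabs and shifted boxes are
inline sets; criticalProb/theta/bondPercolation/openConnIn/criticalProbI are prelude declarations. A
prover may introduce
`decoratedLattice m` in the Theorems file and prove the items by `show`.

Novelty: Searches (2026-08-15): `lit search --hybrid …` local index DOWN (searchd connection reset, 2 tries);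
`lit galaxy search "percolation
occurs at the critical point bounded degree graph rough isometric" --star all` (0 rows; panama/pdf
queued out); `lit search --source
crossref`: "inhomogeneous percolation incipient infinite cluster Chayes Durrett" (5: CCD88
Mandelbrot, Sapozhnikov 2011, none
graph-inhomogeneous), "percolation at criticality quasi-isometry invariance counterexample" (6, none
on percolation), "strict
inequality critical probability enhancement periodic sublattice" (5, none relevant), "Supercritical
percolation on graphs of
polynomial growth" (doi:10.1215/00127094-2023-0032, transitive only), "Percolation on dual lattices
with k-fold symmetry"
(doi:10.1002/rsa.20205); `lit search --source s2 "essential enhancements revisited"`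
(arXiv:1402.0834, arXiv:2003.00932); arXiv /
OpenAlex / further S2 rate-limited (429); held GrimmettPercolation1999 read at §3.3 p.66 (Example
B), Thm (7.61) p.178, Lemma (7.78)
p.182, Lemma (7.89) p.186, Thm (11.55) + p.306; tree:
Literature.Barriers.CriticalPhenomena.TreesPercolatingAtCriticality audit
lines (gap "rough-isometric to ℤ^d … not vendored"), 136 idea cards of the sub (only
graph-perturbation negative card), 9 Theses,
`ledger negatives` (1 SAW item).
Nearest prior art found: ChayesChayesDurrett1987 Thm 2 (position-dependent densities on ℤ²,
incipient infinite cluster — parameter-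
not graph-inhomogeneous); GrimmettPercolation1999  [refs: 10.1215/00127094-2023-0032, 10.1002/rsa.20205, 1402.0834, 2003.00932, doi:10.1215/00127094-2023-0032, doi:10.1002/rsa.20205, GrimmettPercolation1999, ChayesChayesDurrett1987, AngelHutchcroft2018, LyonsPeres2016, AizenmanGrimmett1991, GrimmettMarstrand1990, Pisztora1996, ContrerasMartineauTassion2024]

Barriers (technique_class: counterexample graph-enhancement static-renormalisation): - technique_class: counterexample graph-enhancement static-renormalisation
- Literature.Barriers.CriticalPhenomena.TreesPercolatingAtCriticality: SHARPENED, not evaded — the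
target is a witness inside the class its audit lists as unblocked (subexponential growth,
rough-isometric to ℤ³, amenable, p_c = p_c(ℤ³) < 1); consistent with CriticalTreesExponentialGrowth
(no tree involved).
- Literature.Barriers.CriticalPhenomena.SubexponentialGrowthZd: complementary — that entry says
growth/MTP METHODS are void on ℤ³; this route supplies an actual cubic-growth object percolating at
p_c, so geometry-only arguments are void too.
- Literature.Barriers.CriticalPhenomena.AmenableInvariantPercolation: G is amenable with i.i.d.
edges and a.s. unique infinite cluster; the route shows amenability + independence + uniqueness do
not force θ(p_c) = 0 without transitivity — consistent with, and sharper than, the entry.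
- Literature.Barriers.CriticalPhenomena.SprinklingRenormalisation: used legitimately — on shell k
the decorated lattice is STRICTLY slab-supercritical at p_c(ℤ³) (crux 2), so the
Grimmett–Marstrand/peeling sprinkling has room p_c(ℤ³) − p_c(S_K(D_{m_k})) > 0 at fixed k; no η → 0
limit is ever taken.
- Literature.Barriers.CriticalPhenomena.SlabLimitUniformControl: not met — nothing passes to the
slab limit at criticality; the only uniformity asked (AG gain uniform in the width K, crux 2) lives
strictly inside the supercritical phase of a fixed D_m, and the GM-port alternative avoids e

History (route lifecycle, newest last):
- 2026-08-15T13:47:57Z · CLOSED retired — not-a-thesis: assembly does not conclude the sub-problem Statement (operator:999:1257524)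

sub-problem: PercolationContinuityZ3 · status: closed(retired) · opened planner-plancard-CriticalPhenomena-Percolatio-67f8f5b4-0 2026-08-15T11:41:54Z · rev 1 · ledger route-CriticalPhenomena-PercCCDGraph
GENERATED by the gate from the ledger (D-0016/17). Provers cite these decls: `theorem foo : Summit.CriticalPhenomena.PercolationContinuityZ3.Theses.PercCCDGraph.<Decl> := …` in Summits/CriticalPhenomena/PercolationContinuityZ3/Theorems/<Name>.lean.
-/

namespace Summit.CriticalPhenomena.PercolationContinuityZ3.Theses.PercCCDGraph

open scoped BigOperators Topology Manifold Classical MeasureTheory ProbabilityTheory Matrix InnerProductSpace ComplexConjugate ContinuousMap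
open Filter Set Function TopologicalSpace MeasureTheory

attribute [summit_statement] _root_.PercolationContinuityZ3

/-- item stmt-CriticalPhenomena-5626 · target · rank 0 · closed · moot by None · by planner
why it might fail: Only through the engine: if no decorated lattice D_m is strictly slab-supercritical at p_c(ℤ³) (crux 2 false for all large m) the shell gluing has nothing to run on; the statement itself fails only if sparse periodic essential enhancements did not lower p_c.
sources: ChayesChayesDurrett1987, AizenmanGrimmett1991, GrimmettMarstrand1990, GrimmettPercolation1999, AngelHutchcroft2018
[target] the Chayes–Chayes–Durrett graph over ℤ³: a unit-cube supergraph G of ℤ³ (same vertices,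
extra edges only between sites at sup-distance 1) with criticalProb G 0 = criticalProb ℤ³ 0 and
θ_G(0; p_c(ℤ³)) > 0 (card ccd-decorated-lattice, item r2). -/
@[route_item "route-CriticalPhenomena-PercCCDGraph"]
def CCDGraphZ3 : Prop :=
  ∃ G : SimpleGraph (Literature.Probability.LatticeModels.Site 3), Literature.Probability.LatticeModels.zdGraph 3 ≤ G ∧ (∀ x y : Literature.Probability.LatticeModels.Site 3, G.Adj x y → ∀ i, |x i - y i| ≤ 1) ∧ Literature.Probability.Percolation.criticalProb G 0 = Literature.Probability.Percolation.criticalProb (Literature.Probability.LatticeModels.zdGraph 3) 0 ∧ 0 < Literature.Probability.Percolation.theta G 0 (Literature.Probability.Percolation.criticalProbI 3)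

/-- item stmt-CriticalPhenomena-5627 · crux · rank 2 · closed · moot by None · by planner
why it might fail: Needs the AG gain in slabs bounded below uniformly in the width K (to beat the GM gap p_c(S_K)−p_c→0) or a Grimmett–Marstrand theorem for the quasi-transitive D_m; both expected, neither written, and BBR (arXiv:1402.0834) found gaps in AG-type proofs.
sources: AizenmanGrimmett1991, GrimmettMarstrand1990, GrimmettPercolation1999, BalisterBollobasRiordan2014, MartineauTassion2017, ContrerasMartineauTassion2024
[crux] for every period m ≥ 1 the decorated lattice D_m := ℤ³ ⊔ {all unit-cube edges at the sites of
(mℤ)³} has a slab S_K = {0 ≤ x₂ ≤ K} whose induced graph has critical point (at the origin) STRICTLY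
below p_c(ℤ³): the enhancement's supercriticality at p_c(ℤ³) is slab-visible (card items r3/S3 in
the refuter's fixed-pattern form). Two proofs foreseen: (i) Grimmett–Marstrand for ℤ³ (PROVED,
GrimmettMarstrand1990_blocks_holds: p_c(S_K(ℤ³)) ↓ p_c) plus an Aizenman–Grimmett gain p_c(S_K(ℤ³))
− p_c(S_K(D_m)) ≥ δ(m) > 0 uniform in K ≥ K₀(m) (the AG local surgery has finitely many local types
uniformly in K); (ii) port GM's dynamic renormalisation to the mℤ³-periodic, hyperoctahedrally
symmetric D_m and use AG on the full lattice (GrimmettPercolation1999 §3.3 Example B). [difficulty: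
L] -/
@[route_item "route-CriticalPhenomena-PercCCDGraph"]
def DecoratedSlabsSupercritical : Prop :=
  ∀ m : ℕ, 1 ≤ m → let D : SimpleGraph (Literature.Probability.LatticeModels.Site 3) := Literature.Probability.LatticeModels.zdGraph 3 ⊔ SimpleGraph.fromRel (fun x y : Literature.Probability.LatticeModels.Site 3 => (∀ i, (m : ℤ) ∣ x i) ∧ ∀ i, |x i - y i| ≤ 1); ∃ K : ℕ, Literature.Probability.Percolation.criticalProb (D.induce {x : Literature.Probability.LatticeModels.Site 3 | 0 ≤ x 2 ∧ x 2 ≤ K}) ⟨0, by simp⟩ < Literature.Probability.Percolation.criticalProb (Literature.Probability.LatticeModels.zdGraph 3) 0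

/-- item stmt-CriticalPhenomena-5628 · crux · rank 3 · closed · moot by None · by planner
why it might fail: Thm (7.61)/Lemma (7.89) (crossing cluster + local uniqueness by orange-peeling with slab seeds and p′<p sprinkling) are written for ℤ^d using all its symmetries; D_m is only mℤ³-periodic with point symmetry at decorated sites, and uniqueness is asked at extent ratio 1/6 with a summable rate.
sources: GrimmettPercolation1999, Pisztora1996, GrimmettMarstrand1990, ContrerasMartineauTassion2024
[crux] static renormalisation for the decorated lattices (Grimmett 1999 Thm (7.61) / Pisztora ported
to D_m): if some slab of D_m has critical point strictly below p, then at parameter p the block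
events V_m(x, n) — (a) the box B(x,n) = x + [−n,n]³ contains an open cluster joining, inside B(x,n),
the two opposite faces in each of the three directions; (b) any two open paths inside B(x,3n), each
of sup-extent ≥ n, are joined by an open path inside B(x,3n) — fail with probability whose supremum
over the centre x is summable along the dyadic scales n = 2^j (exponential in n is expected). This
is the fixed-pattern engine of the shell gluing; periodicity makes the supremum a finite maximum.
[deps: DecoratedSlabsSupercritical] [difficulty: XL] -/
@[route_item "route-CriticalPhenomena-PercCCDGraph"]
def SlabsToBlocks : Prop :=
  ∀ m : ℕ, 1 ≤ m → let D : SimpleGraph (Literature.Probability.LatticeModels.Site 3) := Literature.Probability.LatticeModels.zdGraph 3 ⊔ SimpleGraph.fromRel (fun x y : Literature.Probability.LatticeModels.Site 3 => (∀ i, (m : ℤ) ∣ x i) ∧ ∀ i, |x i - y i| ≤ 1); ∀ p : unitInterval, (∃ K : ℕ, Literature.Probability.Percolation.criticalProb (D.induce {x : Literature.Probability.LatticeModels.Site 3 | 0 ≤ x 2 ∧ x 2 ≤ K}) ⟨0, by simp⟩ < p) → Summable (fun j : ℕ => ⨆ x : Literature.Probability.LatticeModels.Site 3, (Literature.Probability.Percolation.bondPercolation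 D p).real {ω | (∃ a ∈ {y : Literature.Probability.LatticeModels.Site 3 | ∀ i, |y i - x i| ≤ 2 ^ j}, ∀ i : Fin 3, ∃ y ∈ {y : Literature.Probability.LatticeModels.Site 3 | ∀ i, |y i - x i| ≤ 2 ^ j}, ∃ z ∈ {y : Literature.Probability.LatticeModels.Site 3 | ∀ i, |y i - x i| ≤ 2 ^ j}, y i = x i - 2 ^ j ∧ z i = x i + 2 ^ j ∧ ω ∈ Literature.Probability.Percolation.openConnIn {y : Literature.Probability.LatticeModels.Site 3 | ∀ i, |y i - x i| ≤ 2 ^ j} a y ∧ ω ∈ Literature.Probability.Percolation.openConnIn {y : Literature.Probability.LatticeModels.Site 3 | ∀ i, |y i - x i| ≤ 2 ^ j} a z) ∧ (∀ a a' b b' : Literature.Probability.LatticeModels.Site 3, ω ∈ Literature.Probability.Percolation.openConnIn {y : Literature.Probability.LatticeModels.Site 3 | ∀ i, |y i - x i| ≤ 3 * 2 ^ j} a a' → ω ∈ Literature.Probability.Percolation.openConnIn {y : Literature.Probability.LatticeModels.Site 3 | ∀ i, |y i - x i| ≤ 3 * 2 ^ j} b b' → (∃ i, (2 : ℤ) ^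 j ≤ |a i - a' i|) → (∃ i, (2 : ℤ) ^ j ≤ |b i - b' i|) → ω ∈ Literature.Probability.Percolation.openConnIn {y : Literature.Probability.LatticeModels.Site 3 | ∀ i, |y i - x i| ≤ 3 * 2 ^ j} a b)}ᶜ)

/-- item stmt-CriticalPhenomena-5629 · crux · rank 4 · closed · moot by None · by planner
why it might fail: Statement-level risk is low; the proof needs p_c(D)+p_c(D*)=1 for a 2-fold-symmetric decorated planar lattice (Bollobás–Riordan 2008) or an RSW theory for it, plus strict p_c(D)<1/2 (planar AG); a gadget lacking the symmetry breaks the duality step.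
sources: ChayesChayesDurrett1987, BollobasRiordan2008, AizenmanGrimmett1991, GrimmettPercolation1999, DuminilCopinTassionCMP2016
[crux] planar warm-up (card item r4): a unit-square supergraph G of ℤ² (extra edges only between
sites at sup-distance 1) with criticalProb G 0 = criticalProb ℤ² 0 (= 1/2 by Kesten, not needed in
this form) and θ_G(0; p_c(ℤ²)) > 0. Intended: NE-diagonals on the lines m_k ∣ x₀ − x₁ (planar,
2-fold symmetric, period m_k), sparser on outer dyadic shells; on shell k the decorated planar
lattice is strictly supercritical at 1/2 (AG in the plane), its dual strictly subcritical
(p_c(D)+p_c(D*)=1 for symmetric planar lattices, BollobasRiordan2008; quasi-transitive sharpness,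
PROVED in tree), so open circuits in dyadic annuli exist with summable failure and glue by planarity
— CCD87's proof with the graph in place of the parameter. Already a clean new example: a
bounded-degree planar graph rough-isometric to ℤ² with p_c = 1/2 percolating at criticality.
[difficulty: L] -/
@[route_item "route-CriticalPhenomena-PercCCDGraph"]
def CCDGraphZ2 : Prop :=
  ∃ G : SimpleGraph (Literature.Probability.LatticeModels.Site 2), Literature.Probability.LatticeModels.zdGraph 2 ≤ G ∧ (∀ x y : Literature.Probability.LatticeModels.Site 2, G.Adj x y → ∀ i, |x i - y i| ≤ 1) ∧ Literature.Probability.Percolation.criticalProb G 0 = Literature.Probability.Percolation.criticalProb (Literature.Probability.LatticeModels.zdGraph 2) 0 ∧ 0 < Literature.Probability.Percolation.theta G 0 (Literature.Probability.Percolation.criticalProbI 2)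

/-- item stmt-CriticalPhenomena-5630 · support · rank 9 · closed · moot by None · by planner
sources: GrimmettPercolation1999, DuminilCopinTassionCMP2016, AntunovicVeselic2007
[support] the critical points of the decorated lattices tend to p_c(ℤ³) as the decoration rarefies:
for every real p < p_c(ℤ³) there is M with p < p_c(D_m) for all m ≥ M (card item S2). Proof: at p′ ∈
(p, p_c(ℤ³)) the ℤ³-susceptibility is finite (PROVED quasi-transitive sharpness,
summable_real_openConn_of_lt_criticalProb), so a D_m-cluster is dominated by a branching process of
ℤ³-clusters linked through open gadget edges whose mean offspring is ≤ 27·20·Σ_{‖w‖≥m−2} τ_{p′}(w) →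
0; hence θ_{D_m}(p′) = 0 and p < p′ ≤ p_c(D_m) for m ≥ M(p′). [difficulty: M] -/
@[route_item "route-CriticalPhenomena-PercCCDGraph"]
def EnhancementThresholdLimit : Prop :=
  ∀ p : ℝ, p < Literature.Probability.Percolation.criticalProb (Literature.Probability.LatticeModels.zdGraph 3) 0 → ∃ M : ℕ, ∀ m : ℕ, M ≤ m → p < Literature.Probability.Percolation.criticalProb (Literature.Probability.LatticeModels.zdGraph 3 ⊔ SimpleGraph.fromRel (fun x y : Literature.Probability.LatticeModels.Site 3 => (∀ i, (m : ℤ) ∣ x i) ∧ ∀ i, |x i - y i| ≤ 1)) 0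

/-- item stmt-CriticalPhenomena-5631 · assembly · rank 1 · closed · moot by None · by planner
sources: ChayesChayesDurrett1987, GrimmettPercolation1999
[assembly] DecoratedSlabsSupercritical → SlabsToBlocks → EnhancementThresholdLimit → CCDGraphZ3
(shell construction with patterns fixed first and radii chosen afterwards; conclusion = the barrier,
not the conjunct). -/
@[route_item "route-CriticalPhenomena-PercCCDGraph"]
def Assembly : Prop :=
  DecoratedSlabsSupercritical → SlabsToBlocks → EnhancementThresholdLimit → CCDGraphZ3

end Summit.CriticalPhenomena.PercolationContinuityZ3.Theses.PercCCDGraph
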